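/-
Copyright: lit-balaban cell, Phase-2 proof seat p24 (gen 24).  Released under Apache 2.0 license as described in the
file LICENSE.
-/
import Literature.MathematicalPhysics.QuantumFieldTheory.Balaban1983to89.B4Eq246SolvesEq244
import Literature.MathematicalPhysics.QuantumFieldTheory.Balaban1983to89.B4Eq247TransformGQ

/-!
# `Balaban1983to89.B4Eq246SquareSummable` — [Balaban1983RegularityDecay] p. 584: «φ₀ = G_jf» TWO-SIDED — the inverse transform
# (2.43) of the formula (2.46) is square-summable on `ξℤ^d` and is THE `ℓ²` solution of the basic equation (2.44); `G_jQ_j^*` is the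
# operator of the kernel (2.48)

statement-level skeleton of published theorems with citation tags; proofs where landed; nothing here is a claim about
the Yang–Mills mass gap

CITATION HEADER.  T. Bałaban, *Regularity and decay of lattice Green's functions*, Commun. Math. Phys. **89** (1983)
571–597, doi:10.1007/bf01214744 [Balaban1983RegularityDecay] (cell paper B4; held text
`paper:balaban1983-cmp89-regularity-decay`, journal page = PDF page + 570), p. 584 [PDF 14] (2.43)–(2.46), p. 585 [PDF 15]
(2.47)–(2.48); renders `pub-balaban/b2b-balaban-ref1/pages/1983-cmp89-regularity-decay/1983-cmp89-regularity-decay-p014-x2.png`,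
`…-p015-x2.png` (unit `lit-balaban-p24` gen 24; HOME `run/shared/lean/pub/lit-balaban/`; SKELETON row **B4.Eq2.43**, cells only —
the row is proved-headed; this file closes HONEST SCOPE (ii) of `B4Eq246SolvesEq244` («this file does not prove that `G246 f` is
summable or square-summable … so the uniqueness theorems … are not invoked here»)).

WHAT IS PRINTED (p. 584).  «We apply it [the transform (2.43)] to the basic equation (−Δ^ξ + m_j² + a_jQ_j^*Q_j)φ₀ = f. (2.44)
Defining the propagator G_j, φ₀ = G_jf, we get [(2.45)].  Solving this equation we obtain the following formula: (2.46).»;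
p. 585: «To calculate G_jQ_j^*, we take f = Q_j^*g in this formula … From this we obtain finally the following formula for
(G_jQ_j^*)(x,y), (2.48)».  The words «the propagator G_j, φ₀ = G_jf» name THE solution of (2.44); the tree had the two halves
separately — every summable / square-summable solution is given by (2.46) (`B4Eq246SummableSolution`, `B4Eq244L2Unique`) and
the inverse transform `G246 f` of (2.46) solves (2.44) (`B4Eq246SolvesEq244.opD_G246`) — without knowing that `G246 f` lies in a
class where uniqueness holds.  This file supplies that membership.

WHAT THIS MODULE PROVES (kernel-checked; theorems only — no definition, no `Prop` fact, 0 `sorry`; axioms standard).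
* §1 **Bessel's inequality for lattice kernels** (the `≤` half of Plancherel's identity on `T^d`, [Grafakos2014] Prop. 3.2.7 (1),
  in the `[−π,π]^d` normalisation): for a multiplier `G` continuous on the real zone `[−π,π]^d`,
  `Σ_{x∈S}|K(x)|² ≤ (2π)^{−d}∫_{[−π,π]^d}|G(p)|²dp` for every finite `S ⊂ ℤ^d` (`sum_normSq_latticeKernel_le`), hence
  `K ∈ ℓ²(ℤ^d)` (`summable_normSq_latticeKernel`, `tsum_normSq_latticeKernel_le`), `K = B4ContourShift.latticeKernel G`; proved
  from first principles (`0 ≤ ∫|G − Σ_{x∈S}K(x)e^{−ip·x}|²` expanded, the plane waves being orthogonal on the zone with square norm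
  `(2π)^d`, `B4Green244.fourierBox_one`), no `L²`-space machinery.
* §2 `G246_finePt`: along the block row of offset `τ`, `x⁰ ↦ (G_jf)(ξ(nx⁰+τ))` is the lattice kernel of the continuous fibre
  multiplier `p′ ↦ Σ_l e^{i(p′+l)·τ/n} sol246(p′)_l` (`continuous_rowMultiplier`; the block phase `e^{ip′·x⁰}` of (2.43) factors out).
* §3 **`summable_normSq_G246`: `G_jf ∈ ℓ²(ξℤ^d)`** for every summable `f` (`m² > 0`, `a ≥ 0`), block row by block row (§1) and
  then over the `n^d` offsets (`B4Eq245Aliasing.blockEquiv`).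
* §4 **`G246_eq_of_solution_l2`: «φ₀ = G_jf» TWO-SIDED** — every square-summable solution of (2.44) IS `G246 f` (`d ≥ 1`;
  `B4Eq244L2Unique.opD_injective_l2`); `G246_eq_of_solution` (every summable solution); **`existsUnique_l2_solution`**: for every
  `f ∈ ℓ¹` the equation (2.44) has exactly one `ℓ²` solution.
* §5 `summable_norm_opD` (`D = −Δ^ξ + m² + aQ_j^*Q_j` maps `ℓ¹` into `ℓ¹`) and **`G246_opD`: `G_j(Dφ) = φ`** for `φ ∈ ℓ¹` — with
  `opD_G246` (`D(G_jf) = f`) the propagator `G_j` is the two-sided inverse of `D` between `ℓ¹` data and `ℓ²` solutions.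
* §6 **`G246_blockSource_eq_GQ`: `G_j(Q_j^*g) = Σ_y K(·,y)g(y)`** (`= B4Eq247TransformGQ.GQ g`) for `g ∈ ℓ¹(ℤ^{d+1})`, `a > 0`, `m² > 0`,
  and `G246_blockIndicator_eq_K`: **`K(z,y) = (G_jQ_j^*δ_y)(ξz)`** — the kernel (2.48) of `B4Green244` is the propagator of (2.46)
  applied to the indicator of the block `B(y)`, i.e. the printed passage from (2.46) to (2.48) holds for the objects of record.

DICTIONARY / HONEST SCOPE.  (i) `A = 0`, infinite lattice `ξℤ^d`, scalar fields, `ξ = 1/n`, `n = L^j ≥ 1`; `a_j ↦ a`, `m_j² ↦ m²`;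
hypotheses as stated per theorem (`m² > 0` throughout §§3–6 so that (2.46) has no vanishing denominator at real momenta; `d ≥ 1`
where `B4Eq244L2Unique` is invoked; §6 in dimension `d+1` with `a > 0`, the setting of `B4Green244.K_decay`).  (ii) Bessel, not
Parseval: §1 proves the inequality only (all that membership needs); no decay of `G_j(x,x′)` itself is claimed (print proves decay for
`G_jQ_j^*`, (2.35)–(2.36), which the tree has as `K_decay` / `B4StripSumsHolder`).  (iii) Value = the kernel certificate that «the
propagator G_j» of p. 584 is a well-defined operator `ℓ¹(ξℤ^d) → ℓ²(ξℤ^d)` given by (2.46) and inverse to `−Δ^ξ + m² + aQ_j^*Q_j`,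
and that `G_jQ_j^*` is the kernel (2.48); cells of row B4.Eq2.43 only; NOT summit progress.
-/

namespace Literature.MathematicalPhysics.QuantumFieldTheory.Balaban1983to89.B4Eq246SquareSummable

open Complex Finset MeasureTheory
open Literature.MathematicalPhysics.QuantumFieldTheory.Balaban1983to89.B4Strip
open Literature.MathematicalPhysics.QuantumFieldTheory.Balaban1983to89.B4ContourShift
open Literature.MathematicalPhysics.QuantumFieldTheory.Balaban1983to89.B4StripSums
open Literature.MathematicalPhysics.QuantumFieldTheory.Balaban1983to89.B4StripSumsHolder
open Literature.MathematicalPhysics.QuantumFieldTheory.Balaban1983to89.B4Green244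
open Literature.MathematicalPhysics.QuantumFieldTheory.Balaban1983to89.B4Eq243TransformSummable
open Literature.MathematicalPhysics.QuantumFieldTheory.Balaban1983to89.B4Eq245Aliasing
open Literature.MathematicalPhysics.QuantumFieldTheory.Balaban1983to89.B4Eq246Fibre
open Literature.MathematicalPhysics.QuantumFieldTheory.Balaban1983to89.B4Eq246SummableSolution
open Literature.MathematicalPhysics.QuantumFieldTheory.Balaban1983to89.B4Eq246SolvesEq244
open Literature.MathematicalPhysics.QuantumFieldTheory.Balaban1983to89.B4Eq247TransformGQ
open scoped Real ComplexConjugate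

noncomputable section

variable {d : ℕ}

/-! ### §1 Bessel's inequality for the lattice kernel of a zone-continuous multiplier -/

/-- the Brillouin zone is compact. [folklore] -/
private theorem isCompact_BZ : IsCompact (BZ d) := by
  unfold BZ; exact isCompact_Icc

/-- the conjugate of the reflected plane wave `e^{−ip·x}` is `e^{ip·x}` (real `p`). [folklore] -/
private theorem conj_cexp_neg_phase (p : Fin d → ℝ) (x : Fin d → ℤ) :
    conj (cexp (-(I * phase p x))) = cexp (I * phase p x) := by
  rw [phase_eq_ofReal, ← Complex.exp_conj, map_neg, map_mul, Complex.conj_I, Complex.conj_ofReal]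
  congr 1
  ring

/-- `e^{−ip·x} e^{ip·y} = e^{ip·(y−x)}`. [folklore] -/
private theorem cexp_neg_phase_mul_cexp_phase (p : Fin d → ℝ) (x y : Fin d → ℤ) :
    cexp (-(I * phase p x)) * cexp (I * phase p y) = cexp (I * phase p (y - x)) := by
  rw [← Complex.exp_add]
  congr 1
  have h : phase p y = phase p (y - x) + phase p x := by rw [← phase_add, sub_add_cancel]
  rw [h]
  ring

/-- `∫_{[−π,π]^d} e^{ip·z} dp = (2π)^d δ_{z,0}`. [folklore] -/
private theorem integral_cexp_phase (z : Fin d → ℤ) :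
    ∫ p in BZ d, cexp (I * phase p z) = if z = 0 then (2 * π : ℂ) ^ d else 0 := by
  have h := fourierBox_one (d := d) z
  unfold fourierBox integrand at h
  simp_rw [one_mul] at h
  exact h

/-- `∫_{[−π,π]^d} G(p) e^{ip·x} dp = (2π)^d K(x)`. [folklore] -/
private theorem fourierBox_eq_mul_latticeKernel (Gm : (Fin d → ℂ) → ℂ) (x : Fin d → ℤ) :
    fourierBox Gm x = (((2 * π) ^ d : ℝ) : ℂ) * latticeKernel Gm x := by
  unfold latticeKernel
  rw [Complex.real_smul, ← mul_assoc, ← Complex.ofReal_mul, mul_inv_cancel₀ (by positivity), Complex.ofReal_one,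
    one_mul]

/-- a plane wave `p ↦ e^{±ip·x}` is continuous in the real momentum. [folklore] -/
private theorem continuous_cexp_phase (x : Fin d → ℤ) : Continuous fun p : Fin d → ℝ => cexp (I * phase p x) := by
  unfold phase; fun_prop

/-- the real part of a set integral of a complex function is the integral of the real part. [folklore] -/
private theorem integral_re_eq {f : (Fin d → ℝ) → ℂ} {s : Set (Fin d → ℝ)} (hf : IntegrableOn f s) :
    ∫ p in s, (f p).re = (∫ p in s, f p).re := by
  have h := integral_re hf
  simpa only [RCLike.re_to_complex] using h

/-- **BESSEL'S INEQUALITY FOR LATTICE KERNELS** (finite form): for a multiplier `G` continuous on the real zone `[−π,π]^d`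
and every finite set `S ⊂ ℤ^d`, `Σ_{x∈S} |K(x)|² ≤ (2π)^{−d} ∫_{[−π,π]^d} |G(p)|² dp`, `K(x) = (2π)^{−d}∫ G(p)e^{ip·x}dp` —
the plane waves `e^{ip·x}` are orthogonal on the zone with square norm `(2π)^d`, so
`0 ≤ ∫|G − Σ_{x∈S} K(x)e^{−ip·x}|² = ∫|G|² − (2π)^d Σ_{x∈S}|K(x)|²`.  This is the BESSEL HALF (`≤`, finite partial sums) of
Plancherel's identity on the torus `‖f‖²_{L²(T^n)} = Σ_{m∈ℤ^n}|f̂(m)|²`, read on the fundamental domain `[−π,π]^d` with the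
lattice normalisation `(2π)^{−d}dp` (the tree's `Literature.Analysis.FunctionSpaces.Lattice.tsum_enorm_sq_eq_lintegral_cube` is the
same identity for `ℓ¹` coefficient families; here the datum is the multiplier). [cite: Grafakos2014, Prop. 3.2.7 (1)] -/
theorem sum_normSq_latticeKernel_le {Gm : (Fin d → ℂ) → ℂ} (hG : ContinuousOn (fun p : Fin d → ℝ => Gm (ofRealVec p)) (BZ d))
    (S : Finset (Fin d → ℤ)) :
    ∑ x ∈ S, ‖latticeKernel Gm x‖ ^ 2 ≤ ((2 * π) ^ d)⁻¹ * ∫ p in BZ d, ‖Gm (ofRealVec p)‖ ^ 2 := by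
  -- notation
  set c : ℝ := (2 * π) ^ d with hc
  have hc0 : 0 < c := by positivity
  set g : (Fin d → ℝ) → ℂ := fun p => Gm (ofRealVec p) with hg
  set K : (Fin d → ℤ) → ℂ := fun x => latticeKernel Gm x with hK
  set s2 : ℝ := ∑ x ∈ S, ‖K x‖ ^ 2 with hs2
  -- the trigonometric polynomial built from the kernel values on `S`
  set T : (Fin d → ℝ) → ℂ := fun p => ∑ x ∈ S, K x * cexp (-(I * phase p x)) with hT
  have hTc : Continuous T := by
    refine continuous_finsetSum S fun x _ => continuous_const.mul ?_
    unfold phase; fun_prop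
  -- integrability of everything in sight (continuous on the compact zone)
  have hint : ∀ x : Fin d → ℤ, IntegrableOn (integrand Gm x) (BZ d) := fun x =>
    (hG.mul (continuous_cexp_phase x).continuousOn).integrableOn_compact isCompact_BZ
  have hgT : IntegrableOn (fun p => g p * conj (T p)) (BZ d) :=
    (hG.mul (Complex.continuous_conj.comp hTc).continuousOn).integrableOn_compact isCompact_BZ
  have hTT : IntegrableOn (fun p => T p * conj (T p)) (BZ d) :=
    (hTc.mul (Complex.continuous_conj.comp hTc)).continuousOn.integrableOn_compact isCompact_BZ
  have hg2 : IntegrableOn (fun p => ‖g p‖ ^ 2) (BZ d) :=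
    (hG.norm.pow 2).integrableOn_compact isCompact_BZ
  have hT2 : IntegrableOn (fun p => ‖T p‖ ^ 2) (BZ d) :=
    (hTc.norm.pow 2).continuousOn.integrableOn_compact isCompact_BZ
  have hgTre : IntegrableOn (fun p => (g p * conj (T p)).re) (BZ d) :=
    (Complex.continuous_re.comp_continuousOn (hG.mul (Complex.continuous_conj.comp hTc).continuousOn)).integrableOn_compact
      isCompact_BZ
  -- Claim A: `∫ G conj(T) = (2π)^d Σ_{x∈S} |K(x)|²`
  have hA : ∫ p in BZ d, g p * conj (T p) = ((c * s2 : ℝ) : ℂ) := by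
    have h1 : ∀ p, g p * conj (T p) = ∑ x ∈ S, conj (K x) * integrand Gm x p := by
      intro p
      simp only [hT, map_sum, map_mul, conj_cexp_neg_phase, Finset.mul_sum, integrand, hg]
      exact Finset.sum_congr rfl fun x _ => by ring
    simp_rw [h1]
    rw [integral_finsetSum S fun x _ => (hint x).const_mul _]
    have h2 : ∀ x ∈ S, ∫ p in BZ d, conj (K x) * integrand Gm x p = conj (K x) * ((c : ℂ) * K x) := by
      intro x _
      rw [integral_const_mul]
      congr 1
      exact fourierBox_eq_mul_latticeKernel Gm x
    rw [Finset.sum_congr rfl h2, hs2]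
    push_cast
    rw [Finset.mul_sum]
    refine Finset.sum_congr rfl fun x _ => ?_
    rw [mul_left_comm, Complex.conj_mul']
  -- Claim B: `∫ |T|² = (2π)^d Σ_{x∈S} |K(x)|²` (orthogonality of the plane waves)
  have hB : ∫ p in BZ d, T p * conj (T p) = ((c * s2 : ℝ) : ℂ) := by
    have h1 : ∀ p, T p * conj (T p) = ∑ x ∈ S, ∑ y ∈ S, K x * conj (K y) * cexp (I * phase p (y - x)) := by
      intro p
      rw [hT]
      simp only [map_sum, map_mul, conj_cexp_neg_phase]
      rw [Finset.sum_mul]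
      refine Finset.sum_congr rfl fun x _ => ?_
      rw [Finset.mul_sum]
      refine Finset.sum_congr rfl fun y _ => ?_
      rw [← cexp_neg_phase_mul_cexp_phase]
      ring
    simp_rw [h1]
    have hint2 : ∀ x y : Fin d → ℤ, IntegrableOn (fun p => K x * conj (K y) * cexp (I * phase p (y - x))) (BZ d) :=
      fun x y => ((continuous_cexp_phase (y - x)).continuousOn.integrableOn_compact isCompact_BZ).const_mul _
    rw [integral_finsetSum S fun x _ => integrable_finsetSum S fun y _ => hint2 x y]
    have h2 : ∀ x ∈ S, ∫ p in BZ d, ∑ y ∈ S, K x * conj (K y) * cexp (I * phase p (y - x)) = (c : ℂ) * (K x * conj (K x)) := by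
      intro x hx
      rw [integral_finsetSum S fun y _ => hint2 x y]
      have h3 : ∀ y ∈ S, ∫ p in BZ d, K x * conj (K y) * cexp (I * phase p (y - x))
          = if y = x then (c : ℂ) * (K x * conj (K x)) else 0 := by
        intro y _
        rw [integral_const_mul, integral_cexp_phase]
        by_cases hy : y = x
        · subst hy
          rw [if_pos (sub_self y), if_pos rfl, hc]
          push_cast
          ring
        · rw [if_neg (sub_ne_zero.mpr hy), if_neg hy, mul_zero]
      rw [Finset.sum_congr rfl h3, Finset.sum_ite_eq' S x, if_pos hx]
    rw [Finset.sum_congr rfl h2, hs2]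
    push_cast
    rw [Finset.mul_sum]
    refine Finset.sum_congr rfl fun x _ => ?_
    rw [Complex.mul_conj']
  -- the two real integrals
  have hB' : ∫ p in BZ d, ‖T p‖ ^ 2 = c * s2 := by
    have h1 : ∀ p, ‖T p‖ ^ 2 = (T p * conj (T p)).re := by
      intro p
      rw [Complex.mul_conj', ← Complex.ofReal_pow, Complex.ofReal_re]
    simp_rw [h1]
    rw [integral_re_eq hTT, hB, Complex.ofReal_re]
  have hA' : ∫ p in BZ d, (g p * conj (T p)).re = c * s2 := by
    rw [integral_re_eq hgT, hA, Complex.ofReal_re]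
  -- `0 ≤ ∫|G − T|² = ∫|G|² − (2π)^d s2`
  have hkey : ∫ p in BZ d, ‖g p - T p‖ ^ 2 = (∫ p in BZ d, ‖g p‖ ^ 2) - c * s2 := by
    have hpt : ∀ p, ‖g p - T p‖ ^ 2 = ‖g p‖ ^ 2 + (‖T p‖ ^ 2 - 2 * (g p * conj (T p)).re) := by
      intro p
      rw [Complex.sq_norm, Complex.sq_norm, Complex.sq_norm, Complex.normSq_sub]
      ring
    simp_rw [hpt]
    have hI2 : IntegrableOn (fun p => 2 * (g p * conj (T p)).re) (BZ d) := hgTre.const_mul 2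
    have hI1 : IntegrableOn (fun p => ‖T p‖ ^ 2 - 2 * (g p * conj (T p)).re) (BZ d) := hT2.sub hI2
    rw [integral_add hg2 hI1, integral_sub hT2 hI2, integral_const_mul, hB', hA']
    ring
  have hnn : 0 ≤ ∫ p in BZ d, ‖g p - T p‖ ^ 2 := integral_nonneg fun p => sq_nonneg _
  rw [hkey] at hnn
  show s2 ≤ c⁻¹ * ∫ p in BZ d, ‖g p‖ ^ 2
  rw [le_inv_mul_iff₀ hc0]
  linarith

/-- **BESSEL'S INEQUALITY FOR LATTICE KERNELS**: the kernel `K(x) = (2π)^{−d}∫_{[−π,π]^d} G(p)e^{ip·x}dp` of a multiplier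
continuous on the real zone is SQUARE-SUMMABLE over `ℤ^d` (the Bessel half of Plancherel's identity on `T^d`).
[cite: Grafakos2014, Prop. 3.2.7 (1)] -/
theorem summable_normSq_latticeKernel {Gm : (Fin d → ℂ) → ℂ}
    (hG : ContinuousOn (fun p : Fin d → ℝ => Gm (ofRealVec p)) (BZ d)) :
    Summable fun x : Fin d → ℤ => ‖latticeKernel Gm x‖ ^ 2 :=
  summable_of_sum_le (fun _ => sq_nonneg _) (sum_normSq_latticeKernel_le hG)

/-- Bessel's inequality, series form: `Σ_{x∈ℤ^d} |K(x)|² ≤ (2π)^{−d} ∫_{[−π,π]^d} |G(p)|² dp` (the `≤` half of Plancherel's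
identity on `T^d` in the `[−π,π]^d` normalisation). [cite: Grafakos2014, Prop. 3.2.7 (1)] -/
theorem tsum_normSq_latticeKernel_le {Gm : (Fin d → ℂ) → ℂ}
    (hG : ContinuousOn (fun p : Fin d → ℝ => Gm (ofRealVec p)) (BZ d)) :
    ∑' x : Fin d → ℤ, ‖latticeKernel Gm x‖ ^ 2 ≤ ((2 * π) ^ d)⁻¹ * ∫ p in BZ d, ‖Gm (ofRealVec p)‖ ^ 2 :=
  Real.tsum_le_of_sum_le (fun _ => sq_nonneg _) (sum_normSq_latticeKernel_le hG)

/-! ### §2 The block rows of `G_jf` are lattice kernels of continuous fibre multipliers -/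

/-- a block phase `e^{ip′·x⁰}` in the multiplier moves the evaluation point of the kernel from `0` to `x⁰`. [folklore] -/
private theorem latticeKernel_phase_mul_zero (Gm : (Fin d → ℂ) → ℂ) (x : Fin d → ℤ) :
    latticeKernel (fun P => cexp (I * phaseC P x) * Gm P) 0 = latticeKernel Gm x := by
  rw [latticeKernel_phase_mul, zero_add]

/-- the fine plane wave at `z = nx⁰ + τ` is the block phase `e^{ip′·x⁰}` times the wave at the offset `τ`:
`e^{i(p′+l)·(nx⁰+τ)/n} = e^{ip′·x⁰}·e^{i(p′+l)·τ/n}` (`e^{il·x⁰} = 1`) — the factor `e^{ip′(x−y)}` printed in front of the fibre sum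
of (2.48). [cite: Balaban1983RegularityDecay, (2.48) p.585] -/
theorem PhZ_finePt_eq_phase_mul (n : ℕ) [NeZero n] (k : Fin d → Fin n) (x : Fin d → ℤ) (τ : Fin d → Fin n)
    (P : Fin d → ℂ) : PhZ n k (finePt n x τ) P = cexp (I * phaseC P x) * PhZ n k (finePt n 0 τ) P := by
  rw [PhZ_finePt n (NeZero.ne n) k x τ P, PhZ_finePt n (NeZero.ne n) k 0 τ P]
  have h0 : phaseC P 0 = 0 := by simp [phaseC]
  rw [h0, mul_zero, Complex.exp_zero, one_mul]

/-- **THE BLOCK ROWS OF `G_jf`**: along the block row of offset `τ`, `x⁰ ↦ (G_jf)(ξ(nx⁰ + τ))` is the lattice kernel of the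
fibre multiplier `p′ ↦ Σ_l e^{i(p′+l)·τ/n}·sol246(p′)_l` read at `x⁰` (the block phase `e^{ip′·x⁰}` of (2.43) factors out of
the fibre sum). [cite: Balaban1983RegularityDecay, (2.43), (2.46) p.584] -/
theorem G246_finePt (n : ℕ) [NeZero n] (a m2 : ℝ) (f : (Fin d → ℤ) → ℂ) (x : Fin d → ℤ) (τ : Fin d → Fin n) :
    G246 n a m2 f (finePt n x τ)
      = latticeKernel (fun P => ∑ k : Fin d → Fin n, PhZ n k (finePt n 0 τ) P * sol246Fibre n a m2 f P k) x := by
  unfold G246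
  have h : (fun P => ∑ k : Fin d → Fin n, PhZ n k (finePt n x τ) P * sol246Fibre n a m2 f P k)
      = fun P => cexp (I * phaseC P x) * ∑ k : Fin d → Fin n, PhZ n k (finePt n 0 τ) P * sol246Fibre n a m2 f P k := by
    funext P
    rw [Finset.mul_sum]
    refine Finset.sum_congr rfl fun k _ => ?_
    rw [PhZ_finePt_eq_phase_mul n k x τ P, mul_assoc]
  rw [h]
  exact latticeKernel_phase_mul_zero _ x

/-- the fibre multiplier of a block row is continuous in the real reduced momentum (`m² > 0`, `a ≥ 0`, `f ∈ ℓ¹`).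
[cite: Balaban1983RegularityDecay, (2.46) p.584] -/
theorem continuous_rowMultiplier (n : ℕ) [NeZero n] {a m2 : ℝ} (ha : 0 ≤ a) (hm : 0 < m2) {f : (Fin d → ℤ) → ℂ}
    (hf : Summable fun z => ‖f z‖) (τ : Fin d → Fin n) :
    Continuous fun p : Fin d → ℝ =>
      ∑ k : Fin d → Fin n, PhZ n k (finePt n 0 τ) (ofRealVec p) * sol246Fibre n a m2 f (ofRealVec p) k := by
  refine continuous_finsetSum _ fun k _ => ?_
  have hPh : Continuous fun P : Fin d → ℂ => PhZ n k (finePt n 0 τ) P :=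
    continuous_iff_continuousAt.mpr fun q => (differentiableAt_PhZ n k _ q).continuousAt
  exact (hPh.comp continuous_ofRealVec).mul (continuous_sol246Fibre n ha hm hf k)

/-! ### §3 `G_jf ∈ ℓ²(ξℤ^d)` for every summable `f` -/

/-- each block row of `G_jf` is square-summable (Bessel). [cite: Balaban1983RegularityDecay, (2.43), (2.46) p.584] -/
theorem summable_normSq_G246_row (n : ℕ) [NeZero n] {a m2 : ℝ} (ha : 0 ≤ a) (hm : 0 < m2) {f : (Fin d → ℤ) → ℂ}
    (hf : Summable fun z => ‖f z‖) (τ : Fin d → Fin n) :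
    Summable fun x : Fin d → ℤ => ‖G246 n a m2 f (finePt n x τ)‖ ^ 2 := by
  simp_rw [G246_finePt]
  exact summable_normSq_latticeKernel (continuous_rowMultiplier n ha hm hf τ).continuousOn

/-- **`G_jf ∈ ℓ²(ξℤ^d)`**: for every summable `f` (`m² > 0`, `a ≥ 0`) the inverse transform of (2.46) is square-summable
over the fine lattice — block row by block row it is the sequence of Fourier coefficients of a continuous function on the
zone. [cite: Balaban1983RegularityDecay, (2.43)–(2.46) p.584] -/
theorem summable_normSq_G246 (n : ℕ) [NeZero n] {a m2 : ℝ} (ha : 0 ≤ a) (hm : 0 < m2) {f : (Fin d → ℤ) → ℂ}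
    (hf : Summable fun z => ‖f z‖) : Summable fun z : Fin d → ℤ => ‖G246 n a m2 f z‖ ^ 2 := by
  rw [← (blockEquiv n).summable_iff]
  have h3 : (fun z => ‖G246 n a m2 f z‖ ^ 2) ∘ blockEquiv n
      = fun yτ : (Fin d → ℤ) × (Fin d → Fin n) => ‖G246 n a m2 f (finePt n yτ.1 yτ.2)‖ ^ 2 := by
    funext yτ
    simp only [Function.comp, blockEquiv, Equiv.coe_fn_mk]
  rw [h3]
  refine (summable_prod_of_nonneg (fun yτ => sq_nonneg _)).mpr ⟨fun y => (hasSum_fintype _).summable, ?_⟩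
  simp_rw [tsum_fintype]
  exact summable_sum fun τ _ => summable_normSq_G246_row n ha hm hf τ

/-! ### §4 «φ₀ = G_jf» two-sided: `G_jf` is THE square-summable solution of (2.44) -/

/-- **«φ₀ = G_jf» ON `ℓ²(ξℤ^d)`** (`d ≥ 1`, `m² > 0`, `a ≥ 0`, `f ∈ ℓ¹`): every SQUARE-SUMMABLE solution `φ₀` of the basic
equation (2.44) `(−Δ^ξ + m² + aQ_j^*Q_j)φ₀ = f` IS the inverse transform (2.43) of the right-hand side of (2.46) — the
operator is injective on `ℓ²` (`B4Eq244L2Unique.opD_injective_l2`) and `G_jf` is itself an `ℓ²` solution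
(`summable_normSq_G246`, `B4Eq246SolvesEq244.opD_G246`). [cite: Balaban1983RegularityDecay, (2.44)–(2.46) p.584] -/
theorem G246_eq_of_solution_l2 (n : ℕ) [NeZero n] (hd : 0 < d) {a m2 : ℝ} (ha : 0 ≤ a) (hm : 0 < m2)
    {φ₀ f : (Fin d → ℤ) → ℂ} (hf : Summable fun z => ‖f z‖) (hφ : Summable fun z => ‖φ₀ z‖ ^ 2)
    (h : ∀ z, opD n a m2 φ₀ z = f z) : φ₀ = G246 n a m2 f :=
  B4Eq244L2Unique.opD_injective_l2 n hd ha hm.le hφ (summable_normSq_G246 n ha hm hf)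
    fun z => by rw [h z, opD_G246 n ha hm hf z]

/-- **«φ₀ = G_jf» ON `ℓ¹(ξℤ^d)`**: every SUMMABLE solution of (2.44) is `G_jf` (`ℓ¹ ⊂ ℓ²`); with
`B4Eq246SummableSolution.solution_eq_latticeKernel_sol246` this identifies the two position-space readings of (2.46).
[cite: Balaban1983RegularityDecay, (2.44)–(2.46) p.584] -/
theorem G246_eq_of_solution (n : ℕ) [NeZero n] (hd : 0 < d) {a m2 : ℝ} (ha : 0 ≤ a) (hm : 0 < m2)
    {φ₀ f : (Fin d → ℤ) → ℂ} (hf : Summable fun z => ‖f z‖) (hφ : Summable fun z => ‖φ₀ z‖)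
    (h : ∀ z, opD n a m2 φ₀ z = f z) : φ₀ = G246 n a m2 f :=
  G246_eq_of_solution_l2 n hd ha hm hf (Literature.Analysis.FunctionSpaces.Torus.summable_norm_sq_of_summable_norm hφ) h

/-- **THE PROPAGATOR `G_j` ON `ℓ²`: EXISTENCE AND UNIQUENESS** (`d ≥ 1`, `m² > 0`, `a ≥ 0`): for every summable `f` the basic
equation (2.44) has EXACTLY ONE square-summable solution, namely `G_jf = G246 f` — «Defining the propagator G_j, φ₀ = G_jf»
as a two-sided kernel statement for general data. [cite: Balaban1983RegularityDecay, (2.44)–(2.46) p.584] -/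
theorem existsUnique_l2_solution (n : ℕ) [NeZero n] (hd : 0 < d) {a m2 : ℝ} (ha : 0 ≤ a) (hm : 0 < m2)
    {f : (Fin d → ℤ) → ℂ} (hf : Summable fun z => ‖f z‖) :
    ∃! φ : (Fin d → ℤ) → ℂ, (Summable fun z => ‖φ z‖ ^ 2) ∧ ∀ z, opD n a m2 φ z = f z :=
  ⟨G246 n a m2 f, ⟨summable_normSq_G246 n ha hm hf, opD_G246 n ha hm hf⟩,
    fun _ hφ => G246_eq_of_solution_l2 n hd ha hm hf hφ.1 hφ.2⟩

/-! ### §5 `G_j` is a left inverse on `ℓ¹`: `G_j(−Δ^ξ + m² + aQ_j^*Q_j)φ = φ` -/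

/-- `x⁰ ↦ nx⁰ + τ` is injective (distinct blocks have distinct points of the same offset). [folklore] -/
private theorem finePt_injective_left (n : ℕ) [NeZero n] (τ : Fin d → Fin n) :
    Function.Injective fun y : Fin d → ℤ => finePt n y τ := by
  intro y y' h
  have := congrArg (coarse n) h
  simpa only [coarse_finePt] using this

/-- the operator of (2.44) maps `ℓ¹(ξℤ^d)` into itself (finite stencil: centre, `2d` neighbours, the `n^d` points of the
block). [cite: Balaban1983RegularityDecay, (2.44) p.584] -/
theorem summable_norm_opD (n : ℕ) [NeZero n] (a m2 : ℝ) {φ : (Fin d → ℤ) → ℂ} (hφ : Summable fun z => ‖φ z‖) :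
    Summable fun z => ‖opD n a m2 φ z‖ := by
  -- each stencil point, as a function of the centre, gives a summable family
  have hst : ∀ i : Idx d n, Summable fun z => ‖φ (stp n z i)‖ := by
    intro i
    rcases i with ⟨⟨⟩⟩ | ⟨μ | ⟨μ | τ⟩⟩
    · exact hφ
    · show Summable ((fun z => ‖φ z‖) ∘ fun z => z + e μ)
      exact hφ.comp_injective (add_left_injective (e μ))
    · show Summable ((fun z => ‖φ z‖) ∘ fun z => z - e μ)
      exact hφ.comp_injective (sub_left_injective)
    · show Summable fun z => ‖φ (finePt n (coarse n z) τ)‖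
      have h1 : Summable fun y : Fin d → ℤ => ‖φ (finePt n y τ)‖ := by
        show Summable ((fun z => ‖φ z‖) ∘ fun y => finePt n y τ)
        exact hφ.comp_injective (finePt_injective_left n τ)
      exact summable_norm_comp_coarse n (g := fun y => φ (finePt n y τ)) h1
  have hmaj : Summable fun z => ∑ i : Idx d n, ‖stc d n a m2 i‖ * ‖φ (stp n z i)‖ :=
    summable_sum fun i _ => (hst i).mul_left _
  refine Summable.of_nonneg_of_le (fun z => norm_nonneg _) (fun z => ?_) hmaj
  rw [opD_eq_stencil]
  refine (norm_sum_le _ _).trans (le_of_eq ?_)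
  exact Finset.sum_congr rfl fun i _ => norm_mul _ _

/-- **`G_j` IS THE INVERSE OF `−Δ^ξ + m² + aQ_j^*Q_j` ON `ℓ¹`** (`d ≥ 1`, `m² > 0`, `a ≥ 0`): `G_j(Dφ) = φ` for every summable
`φ` (left inverse; the right inverse `D(G_jf) = f` is `B4Eq246SolvesEq244.opD_G246`).
[cite: Balaban1983RegularityDecay, (1.6) p.572, (2.44)–(2.46) p.584] -/
theorem G246_opD (n : ℕ) [NeZero n] (hd : 0 < d) {a m2 : ℝ} (ha : 0 ≤ a) (hm : 0 < m2) {φ : (Fin d → ℤ) → ℂ}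
    (hφ : Summable fun z => ‖φ z‖) : G246 n a m2 (opD n a m2 φ) = φ :=
  (G246_eq_of_solution n hd ha hm (summable_norm_opD n a m2 hφ) hφ fun _ => rfl).symm

/-! ### §6 `G_jQ_j^*` is the operator of the kernel (2.48) -/

/-- **`G_jQ_j^* = Σ_y K(·,y)g(y)`**: for a block source `f = Q_j^*g`, `g ∈ ℓ¹(ℤ^{d+1})` (`a > 0`, `m² > 0`), the inverse
transform of (2.46) IS the operator of the kernel (2.48): `G246 (g ∘ ⌊·/n⌋) = GQ g` — the propagator `G_j` of (2.44)–(2.46)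
composed with `Q_j^*` is the object `G_jQ_j^*` whose kernel and decay the tree certified (`B4Green244.K`, `K_decay`).
[cite: Balaban1983RegularityDecay, (2.46) p.584, (2.47)–(2.48) p.585] -/
theorem G246_blockSource_eq_GQ (n : ℕ) [NeZero n] {a m2 : ℝ} (ha : 0 < a) (hm : 0 < m2)
    {g : (Fin (d + 1) → ℤ) → ℂ} (hg : Summable fun y => ‖g y‖) :
    G246 n a m2 (fun z => g (coarse n z)) = GQ n a m2 g :=
  GQ_eq_of_solution_l2 n ha hm.le (summable_normSq_G246 n ha.le hm (summable_norm_comp_coarse n hg)) hg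
    fun z => opD_G246 n ha.le hm (summable_norm_comp_coarse n hg) z

/-- **THE KERNEL (2.48) IS `G_jQ_j^*δ_y`**: `K(z,y) = (G_j Q_j^*δ_y)(ξz)` — the lattice kernel of `B4Green244` is the
propagator of (2.46) applied to the indicator of the block `B(y)` (`a > 0`, `m² > 0`).
[cite: Balaban1983RegularityDecay, (2.46) p.584, (2.48) p.585] -/
theorem G246_blockIndicator_eq_K (n : ℕ) [NeZero n] {a m2 : ℝ} (ha : 0 < a) (hm : 0 < m2)
    (y z : Fin (d + 1) → ℤ) :
    G246 n a m2 (fun z' => if coarse n z' = y then 1 else 0) z = K n a m2 z y := by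
  have hg : Summable fun y' : Fin (d + 1) → ℤ => ‖(if y' = y then (1 : ℂ) else 0)‖ := by
    refine summable_of_ne_finset_zero (s := {y}) fun y' hy' => ?_
    rw [Finset.mem_singleton] at hy'
    rw [if_neg hy', norm_zero]
  have h := congrFun (G246_blockSource_eq_GQ n ha hm hg) z
  refine h.trans ?_
  unfold GQ
  dsimp only
  rw [tsum_eq_single y (fun y' hy' => by rw [if_neg hy', mul_zero]), if_pos rfl, mul_one]

end

end Literature.MathematicalPhysics.QuantumFieldTheory.Balaban1983to89.B4Eq246SquareSummable
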